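import Summits.BirchSwinnertonDyer.BirchSwinnertonDyer.Theorems.ThetaPartnerAtTwoSignedControlAtTwoRelaxedKummerCountAllLevels
import Summits.BirchSwinnertonDyer.Rank1Residual.X11b.AnticyclotomicEmbedding
import Summits.BirchSwinnertonDyer.Rank1Residual.X11b.AnticyclotomicInfinitePlaces
import Summits.BirchSwinnertonDyer.Rank1Residual.X11b.CoinvariantsDescent
import Summits.BirchSwinnertonDyer.Rank1Residual.Additive.ClassicalConditionAwayBadPlaces
import Literature.NumberTheory.EllipticCurves.IwasawaSelmerProofs
import HarnessLib

/-!
# Weak-Leopoldt growth over the layers, RELAXED ABOVE EVERY PRIME OVER `p`: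
# `p^{k·[K_n:ℚ]} ≤ c(n) · #{Γ_n-level classes killed by p^k, classical at every u ∤ p and at ∞}`
# (crux ♭T′ stmt-BirchSwinnertonDyer-26975, line `sigmacongruence`, brick (1b) Stage B of the growth road to stub TS1)

Route `UniversalToricDescent`, lead prover `bsd-wall-utd-p1` g15. THEOREMS ONLY (no definition, no named fact, no `sorry`);
`--supports stmt-BirchSwinnertonDyer-26975`. BSD is not proved by any of this.

The TP2/RTT INPUTS seat's `relaxedSelmer_torsion_card_growth_of_poitouTate` (Theorems/…RelaxedKummerCountAllLevels) gives Greenberg's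
finite-level count relaxed above ONE `v ∣ p` from Poitou–Tate over the layers `K_n`, with rate `p^{k·[K_n:K]}`. For the RANK-TWO
growth that the strict-place surjectivity of the TWIN needs (memo GROWTH-ROAD-utdp1g15 §1: the target `⊕_{w∣𝔭′} H¹(K_{∞,w}, E′[3^∞])`
grows like `3^{2k·3^n}`), one relaxes above ALL primes over `p` and reads the relative local count over the base `ℚ`:
`p^{k·[K_n:ℚ]} ≤ ∏_{w∣p} #(𝓞_{K_n,w}/p^k)` (`prime_pow_mul_finrank_le_prod_natCard_quot` with `F = ℚ`, `v = (p)`). This file is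
that variant, assembled VERBATIM along §0–§2 of the AllLevels file:

* `relaxedAboveP_torsion_card_growth_of_poitouTate` — for every number field `K`, elliptic `W/K`, `ℤ_p`-extension `κ`, layer `n`
  and exponent `k`: a finite set `F ⊆ H¹(Γ_n, E[p^∞])` of classes killed by `p^k`, with the classical local condition at EVERY
  finite `u ∤ p` (all `Γ_K`-conjugates) and at every infinite place, such that
  `p^{k·pⁿ·[K:ℚ]} ≤ (#E(K̄)[p^∞]^{Γ_{K_n}} · ∏_{w∣∞ of K_n} #H¹(K_{n,w}, E)) · #F`
  — GIVEN `poitouTate_selmerStructure_duality (κ.layer n)` (the route's hPT by name, used at the layer field only).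

For the UTD twin (`K` imaginary quadratic, `E′(K_∞)[3] = 0`): the constant is `1` and the rate `3^{2k·3^n}` is the weak-Leopoldt rate
of `injective_of_weakLeopoldt_growth` (p645087) with `d = 2`, once `F` is pushed into `selmerAc W′_K 3 κ v₀ S` along `layerToInfty`
(`injective_layerToInfty_comp_torsionPow`-type injectivity, p646825; classical at `u ∤ p` = locally trivial = `awayKer`).

References: [GreenbergLNM1716] Thm 1.7 and p. 62, §3 Lemma 3.1; [MilneADT2006] I Thm. 4.10; [GreenbergVatsal2000] §2 Prop. (2.1).
-/

set_option autoImplicit false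
-- the Theorems namespace of this sub repeats the summit name by design (D-0017 nested layout)
set_option linter.dupNamespace false

noncomputable section

open scoped Classical
open CategoryTheory Field NumberField IsDedekindDomain Function
open Literature.NumberTheory.EllipticCurves Literature.NumberTheory.EllipticCurves.GreenbergSelmer
open Literature.NumberTheory.GaloisRepresentations
open Literature.NumberTheory.GaloisCohomology
open scoped ContRepresentation

namespace Summit.BirchSwinnertonDyer.BirchSwinnertonDyer.Theorems.UniversalToricDescentLayerRelaxedGrowth

open Summit.BirchSwinnertonDyer.BirchSwinnertonDyer.Theorems.SignedEC.RelaxedKummerCount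
  Summit.BirchSwinnertonDyer.Rank1Residual.Additive
  Summit.BirchSwinnertonDyer.Rank1Residual.Additive.LocalTransport
  Summit.BirchSwinnertonDyer.Rank1Residual.Additive.BaseChange
  Summit.BirchSwinnertonDyer.Rank1Residual.Additive.ZpTower
  Summit.BirchSwinnertonDyer.BirchSwinnertonDyer.Theorems.EtaLayer
  Summit.BirchSwinnertonDyer.Rank1Residual.X11b
  Summit.BirchSwinnertonDyer.Rank1Residual.X11b.KummerPT Summit.BirchSwinnertonDyer.Rank1Residual.X11b.LocBridge
open scoped NumberField.LiesOver

/-- **Greenberg's finite-level count, relaxed above EVERY prime over `p`, at every layer, from Poitou–Tate over the layer field.**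
For `K` a number field, `W/K` elliptic, `κ` a `ℤ_p`-extension, `n k : ℕ`, GIVEN `poitouTate_selmerStructure_duality (κ.layer n)`:
there is a finite `F ⊆ H¹(Γ_n, E[p^∞])` (`Γ_n = κ.layerSubgroup n`) of classes `y` with `p^k y = 0`, the classical local condition at
every finite `u ∤ p` for every conjugate `conj_σ y`, and at every infinite place, such that
`p^{k·pⁿ·[K:ℚ]} ≤ (#E(K̄_n-points)[p^∞]^{Γ_{K_n}} · ∏_{w∣∞ of K_n} #H¹(K_{n,w}, E)) · #F`. Proof = §3 of the AllLevels file with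
`F = ℚ`, `v = (p)`, `T` = all places of `K_n` above `p`. [cite: GreenbergLNM1716, Thm 1.7 and the paragraph after it (pp. 61–62)]
[cite: MilneADT2006, Ch. I, Thm. 4.10] -/
theorem relaxedAboveP_torsion_card_growth_of_poitouTate {K : Type} [Field K] [NumberField K]
    (W : WeierstrassCurve K) [W.IsElliptic] (p : ℕ) [Fact p.Prime] (κ : ZpExtension K p) (n k : ℕ)
    (hPT : poitouTate_selmerStructure_duality (κ.layer n)) :
    ∃ F : Finset (W.subgroupH1 p (κ.layerSubgroup n)),
      (∀ y ∈ F, p ^ k • y = 0 ∧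
        (∀ u : HeightOneSpectrum (𝓞 K), ((p : ℕ) : 𝓞 K) ∉ u.asIdeal → ∀ σ : absoluteGaloisGroup K,
          W.conjH1 p (κ.layerSubgroup n) σ y ∈ W.localKerOver p (κ.layerSubgroup n) (u.adicCompletion K)) ∧
        (∀ (w : InfinitePlace K) (σ : absoluteGaloisGroup K),
          W.conjH1 p (κ.layerSubgroup n) σ y ∈ W.localKerOver p (κ.layerSubgroup n) w.Completion)) ∧
      p ^ (k * (p ^ n * Module.finrank ℚ K)) ≤
        (Nat.card {m : (W.baseChange (κ.layer n)).geomPrimaryTorsion p |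
            ∀ σ : absoluteGaloisGroup (κ.layer n), σ • m = m} *
          ∏ w : InfinitePlace (κ.layer n),
            Nat.card (galoisCohomology ((W.baseChange (κ.layer n)).localGaloisModule w.Completion) 1)) * F.card := by
  classical
  haveI : PerfectField K := PerfectField.ofCharZero
  -- the layer `L = K_n` and the seam
  set U : Subgroup (absoluteGaloisGroup K) := κ.layerSubgroup n with hUdef
  have hseam : galRange (K := K) (κ.layer n) = U := galRange_layer_eq_layerSubgroup κ n
  have hU : U ≤ galRange (K := K) (κ.layer n) := hseam.ge
  have hH : ∀ τ : absoluteGaloisGroup (κ.layer n), τ ∈ comapResGal (κ.layer n) U := fun τ ↦ by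
    rw [mem_comapResGal_iff, ← hseam]
    exact ⟨τ, rfl⟩
  have hfinrank : Module.finrank ℚ (κ.layer n) = p ^ n * Module.finrank ℚ K := by
    rw [← Module.finrank_mul_finrank ℚ K (κ.layer n), κ.finrank_layer_holds n, mul_comm]
  -- the place of `ℚ` at `p` and the places of `K_n` above `p`
  have hvQ : ((p : ℕ) : 𝓞 ℚ) ∈ (ratPlace p).asIdeal :=
    (natCast_mem_asIdeal_iff_eq_primesEquiv_symm _ Fact.out).mpr rfl
  set I₁ : Ideal (𝓞 (κ.layer n)) := (ratPlace p).asIdeal.map (algebraMap (𝓞 ℚ) (𝓞 (κ.layer n))) with hI₁def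
  have hI₁ : I₁ ≠ ⊥ := by
    rw [hI₁def, Ne, Ideal.map_eq_bot_iff_of_injective (algebraMap_ringOfIntegers_injective ℚ (κ.layer n))]
    exact (ratPlace p).ne_bot
  set T : Finset (HeightOneSpectrum (𝓞 (κ.layer n))) := (Ideal.finite_factors hI₁).toFinset with hTdef
  have hTmem : ∀ w : HeightOneSpectrum (𝓞 (κ.layer n)), w ∈ T ↔ w.asIdeal ∣ I₁ := fun w ↦ by
    rw [hTdef, Set.Finite.mem_toFinset]
    rfl
  have hT : ∀ w : HeightOneSpectrum (𝓞 (κ.layer n)), w.asIdeal ∣ I₁ → w ∈ T := fun w hw ↦ (hTmem w).mpr hw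
  have hTv : ∀ w ∈ T, w.asIdeal.LiesOver (ratPlace p).asIdeal := fun w hw ↦
    liesOver_of_dvd_map ℚ (κ.layer n) (ratPlace p) w ((hTmem w).mp hw)
  -- Side A over `K_n` relaxed above every prime over `p`, transported to `H¹(res⁻¹ U, E_{K_n}[p^∞])`
  obtain ⟨F, hF, hcount⟩ := exists_finset_subgroupH1_of_kummerOutside p (κ.layer n) (W.baseChange (κ.layer n))
    (comapResGal (κ.layer n) U) hH (T.image Sum.inr) k
  have hA := prime_pow_mul_finrank_le_natCard_kummerOutside_mul p ℚ (κ.layer n) (W.baseChange (κ.layer n))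
    hPT (ratPlace p) hvQ k T hT
  -- transport to `H¹(U, E[p^∞])`
  let Ψ := subgroupH1Iso (κ.layer n) W p hU
  refine ⟨F.image Ψ, fun y hy ↦ ?_, ?_⟩
  · obtain ⟨x, hx, rfl⟩ := Finset.mem_image.mp hy
    obtain ⟨hx0, hxfin, hxinf⟩ := hF x hx
    refine ⟨by rw [← map_nsmul, hx0, map_zero], fun u hu σ ↦ ?_, fun w σ ↦ ?_⟩
    · refine conjH1_subgroupH1Iso_mem_localKerOver_adicCompletion W p (κ.layer n) hU u x ?_ σ
      intro w hw τ
      refine hxfin w (fun hmem ↦ ?_) τ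
      have hwT : w ∈ T := (inr_mem_image_inr_iff T w).mp hmem
      have h1 : w.asIdeal.LiesOver (ratPlace p).asIdeal := hTv w hwT
      -- `w ∣ p`, and `w` lies over `u`: so `p ∈ u`, contradicting `u ∤ p`
      have hwp : ((p : ℕ) : 𝓞 (κ.layer n)) ∈ w.asIdeal := by
        refine mem_of_under_eq_ratPlace (K := κ.layer n) (p := p) (HeightOneSpectrum.ext ?_)
        rw [HeightOneSpectrum.under_asIdeal, ← h1.over]
      apply hu
      rw [hw.over, Ideal.under_def, Ideal.mem_comap, map_natCast]
      exact hwp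
    · exact conjH1_subgroupH1Iso_mem_localKerOver_infinitePlace W p (κ.layer n) hU w x
        (fun w' τ ↦ hxinf w' (inl_not_mem_image_inr T w') τ) σ
  · rw [Finset.card_image_of_injective F Ψ.injective, ← hfinrank]
    calc p ^ (k * Module.finrank ℚ (κ.layer n))
        ≤ Nat.card (kummerOutside (W.baseChange (κ.layer n)) (p ^ k) (T.image Sum.inr)) *
          ∏ w : InfinitePlace (κ.layer n),
            Nat.card (galoisCohomology ((W.baseChange (κ.layer n)).localGaloisModule w.Completion) 1) := hA
      _ ≤ (Nat.card {m : (W.baseChange (κ.layer n)).geomPrimaryTorsion p |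
            ∀ σ : absoluteGaloisGroup (κ.layer n), σ • m = m} * F.card) *
          ∏ w : InfinitePlace (κ.layer n),
            Nat.card (galoisCohomology ((W.baseChange (κ.layer n)).localGaloisModule w.Completion) 1) :=
          Nat.mul_le_mul_right _ hcount
      _ = _ := by ring


/-! ## Into Castella's relaxed Selmer group over `K_∞`: classical at `u ∤ p` over `K_n` ⟹ locally trivial over `K_∞` -/

section ToInfty

open Summit.BirchSwinnertonDyer.Rank1Residual.X11b.Coinv Summit.BirchSwinnertonDyer.Rank1Residual.X11b.AcSelmer

variable {K : Type} [Field K] [NumberField K] (W : WeierstrassCurve K) [W.IsElliptic] (p : ℕ) [Fact p.Prime]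
  (κ : ZpExtension K p)

/-- **A layer class with the classical condition at every `u ∤ p` restricts into `Sel^{S}_{v₀}(K_∞, E[p^∞])`** (Castella's group
with a fake strict place `v₀ ∤ p`, i.e. relaxed above `p` and at `S`, locally trivial elsewhere), for `K` totally complex:
`conj_σ ∘ h_n = h_n ∘ conj_σ` (`resOfLe_comp_conjH1`), restriction preserves the classical condition (`resOfLe_mem_localKerOver`),
classical ⟹ locally trivial over `K_∞` at `u ∤ p` (`localKerOver_le_awayKer`, Greenberg's `Im κ_η = 0`), the strict condition at
`v₀` is local triviality (`mem_selmerOver_iff_awayKer`), and complex places impose nothing. [cite: GreenbergLNM1716, §2 Prop. 2.1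
(p. 72), §3 p. 85–87] [cite: Castella2018, Def. 2.2 (arXiv:1704.06608 p. 5)] -/
theorem layerToInfty_mem_selmerAc_of_classical [IsTotallyComplex K] (v₀ : HeightOneSpectrum (𝓞 K))
    (hv₀ : ((p : ℕ) : 𝓞 K) ∉ v₀.asIdeal) (S : Set (HeightOneSpectrum (𝓞 K))) (n : ℕ)
    (y : W.subgroupH1 p (κ.layerSubgroup n))
    (hy : ∀ u : HeightOneSpectrum (𝓞 K), ((p : ℕ) : 𝓞 K) ∉ u.asIdeal → ∀ σ : absoluteGaloisGroup K,
      W.conjH1 p (κ.layerSubgroup n) σ y ∈ W.localKerOver p (κ.layerSubgroup n) (u.adicCompletion K)) :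
    W.layerToInfty κ n y ∈ selmerAc W p κ v₀ S := by
  have hconj : ∀ σ : absoluteGaloisGroup K,
      W.conjH1 p κ.kerSubgroup σ (W.layerToInfty κ n y) = W.layerToInfty κ n (W.conjH1 p (κ.layerSubgroup n) σ y) := by
    intro σ
    have h := congrArg (fun f ↦ f y)
      (resOfLe_comp_conjH1_holds (M := W.geomPrimaryTorsion p) (κ.kerSubgroup_le_layerSubgroup n) σ)
    simp only [AddMonoidHom.coe_comp, Function.comp_apply] at h
    exact h.symm
  have haway : ∀ u : HeightOneSpectrum (𝓞 K), ((p : ℕ) : 𝓞 K) ∉ u.asIdeal → ∀ σ : absoluteGaloisGroup K,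
      W.conjH1 p κ.kerSubgroup σ (W.layerToInfty κ n y) ∈ awayKer κ.kerSubgroup (W.geomPrimaryTorsion p) u := by
    intro u hu σ
    rw [hconj]
    exact localKerOver_le_awayKer p κ u W hu (W.resOfLe_mem_localKerOver p _ _ (hy u hu σ))
  change W.layerToInfty κ n y ∈ selmerOver κ.kerSubgroup (W.geomPrimaryTorsion p) p v₀ S
  rw [mem_selmerOver_iff_awayKer]
  refine ⟨fun v hpv _ σ ↦ haway v hpv σ, fun w σ ↦ ?_, fun σ ↦ haway v₀ hv₀ σ⟩
  exact mem_infKer_of_decompInf_eq_bot w (decompInf_eq_bot_of_isComplex (IsTotallyComplex.isComplex w)) _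

/-- **The weak-Leopoldt growth INSIDE `Sel^{S}_{v₀}(K_∞, E[p^∞])`, at every layer, from Poitou–Tate over the layer field.**
For `K` totally complex, `v₀ ∤ p`, any `S`, `n k : ℕ`, GIVEN `poitouTate_selmerStructure_duality (κ.layer n)` and injectivity
of `h_n : H¹(K_n, E[p^∞]) → H¹(K_∞, E[p^∞])` (e.g. from `E(K_∞)[p^∞] = 0`, `layerToInfty_injective_of_fixedPoints_eq_bot`):
a finite `F ⊆ Sel^{S}_{v₀}(K_∞, E[p^∞])` of classes killed by `p^k` and fixed by `conj_g` for every `g ∈ Γ_n`, with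
`p^{k·pⁿ·[K:ℚ]} ≤ c(n) · #F`, `c(n) = #E(K̄)[p^∞]^{Γ_{K_n}} · ∏_{w∣∞ of K_n} #H¹(K_{n,w}, E)` — the source side of
`injective_of_weakLeopoldt_growth` (p645087) with `d = [K:ℚ]`, read through `natCard_quotient_span_pow_omega_smul` (p646050).
[cite: GreenbergLNM1716, Thm 1.7 and p. 62, §3 Lemma 3.1] [cite: GreenbergVatsal2000, §2 Prop. (2.1)] -/
theorem exists_finset_selmerAc_torsion_invariant_card_ge [IsTotallyComplex K] (v₀ : HeightOneSpectrum (𝓞 K))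
    (hv₀ : ((p : ℕ) : 𝓞 K) ∉ v₀.asIdeal) (S : Set (HeightOneSpectrum (𝓞 K))) (n k : ℕ)
    (hPT : poitouTate_selmerStructure_duality (κ.layer n)) (hinj : Function.Injective (W.layerToInfty κ n)) :
    ∃ F : Finset (selmerAc W p κ v₀ S),
      (∀ s ∈ F, p ^ k • s = 0 ∧ ∀ g ∈ κ.layerSubgroup n,
        W.conjH1 p κ.kerSubgroup g (s : W.subgroupH1 p κ.kerSubgroup) = s) ∧
      p ^ (k * (p ^ n * Module.finrank ℚ K)) ≤
        (Nat.card {m : (W.baseChange (κ.layer n)).geomPrimaryTorsion p |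
            ∀ σ : absoluteGaloisGroup (κ.layer n), σ • m = m} *
          ∏ w : InfinitePlace (κ.layer n),
            Nat.card (galoisCohomology ((W.baseChange (κ.layer n)).localGaloisModule w.Completion) 1)) * F.card := by
  classical
  obtain ⟨F, hF, hcount⟩ := relaxedAboveP_torsion_card_growth_of_poitouTate W p κ n k hPT
  -- push `F` along `h_n` into the Selmer group over `K_∞`
  let Φ : W.subgroupH1 p (κ.layerSubgroup n) → W.subgroupH1 p κ.kerSubgroup := W.layerToInfty κ n
  have hmem : ∀ y ∈ F, Φ y ∈ selmerAc W p κ v₀ S := fun y hy ↦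
    layerToInfty_mem_selmerAc_of_classical W p κ v₀ hv₀ S n y (hF y hy).2.1
  let ι : F → selmerAc W p κ v₀ S := fun y ↦ ⟨Φ y, hmem y y.2⟩
  have hι : Function.Injective ι := fun a b hab ↦
    Subtype.ext (hinj (congrArg (fun z : selmerAc W p κ v₀ S ↦ (z : W.subgroupH1 p κ.kerSubgroup)) hab))
  refine ⟨Finset.univ.image ι, fun s hs ↦ ?_, ?_⟩
  · obtain ⟨y, -, rfl⟩ := Finset.mem_image.mp hs
    obtain ⟨hy0, -, -⟩ := hF y y.2
    refine ⟨Subtype.ext ?_, fun g hg ↦ ?_⟩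
    · change p ^ k • W.layerToInfty κ n y = 0
      rw [← map_nsmul, hy0, map_zero]
    · change W.conjH1 p κ.kerSubgroup g (W.layerToInfty κ n y) = W.layerToInfty κ n y
      have h := congrArg (fun f ↦ f (y : W.subgroupH1 p (κ.layerSubgroup n)))
        (resOfLe_comp_conjH1_holds (M := W.geomPrimaryTorsion p) (κ.kerSubgroup_le_layerSubgroup n) g)
      simp only [AddMonoidHom.coe_comp, Function.comp_apply] at h
      rw [conjH1_of_mem_holds (κ.layerSubgroup n) (W.geomPrimaryTorsion p) hg, AddMonoidHom.id_apply] at h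
      exact h.symm
  · rw [Finset.card_image_of_injective _ hι, Finset.card_univ, Fintype.card_coe]
    exact hcount

end ToInfty

end Summit.BirchSwinnertonDyer.BirchSwinnertonDyer.Theorems.UniversalToricDescentLayerRelaxedGrowth

end
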